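import Literature.Analysis.FluidPDE.Seregin2020ScaledEnergyBounds
import HarnessLib

/-!
# SwirlFreeBudget, brick for crux K-18.2 (T-18.5): the scaled ENSTROPHY from the critical gauges
# `C`, `D` (the input `E` of `EtaMoserBound` in the full CKN gauge) (seat nsreg-p4)

Support file for the DORMANT route `SwirlThreshold` (crux stmt-NavierStokesRegularity-2002) and
planner nsreg-p2's ROUND-18 assembly `EtaMoserBound → SwirlFreePolynomialBound`
(`…Theorems.SwirlFreeBudget`; memo §1 (3), ADDENDUM D (1): "CTZ22 Lemma 3.1 is the tree's
`Seregin2020.localEnergyBound_top`").  From that tree theorem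
(`A_ess(R/2) + E(R/2) ≤ c₁ C(R)^{2/3} + c₂ C(R) + c₃ D(R)^{2/3} C(R)^{1/3}`) and bounds
`C(R), D(R) ≤ M`:

* `cknE_half_le_of_cknC_cknD`: **`E(R/2; z) ≤ (c₁ + c₂ + c₃) · (1 + M)`** — the scaled enstrophy the
  η-Moser lemma starts from is POLYNOMIALLY (indeed linearly) controlled by the full CKN gauge, with
  a universal constant; no solution-dependent data term.

WHAT THIS IS NOT: not NS regularity — bookkeeping on the local energy inequality already in the
tree; `EtaMoserBound`, `SwirlFreePolynomialBound` and all hard cores untouched; no crux claim.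
-/

namespace Summit.NavierStokesRegularity.NavierStokesRegularity.Theorems.SwirlFreeBudget

open Set MeasureTheory TopologicalSpace
open scoped NNReal ENNReal
open Literature.Analysis Literature.Analysis.FluidPDE

noncomputable section

/-- `x^{a} ≤ 1 + x` in `ℝ≥0∞` for `0 ≤ a ≤ 1`. -/
theorem ennreal_rpow_le_one_add {x : ℝ≥0∞} {a : ℝ} (ha0 : 0 ≤ a) (ha1 : a ≤ 1) :
    x ^ a ≤ 1 + x := by
  have h1 : (1 : ℝ≥0∞) ≤ 1 + x := le_self_add
  calc x ^ a ≤ (1 + x) ^ a := ENNReal.rpow_le_rpow le_add_self ha0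
    _ ≤ (1 + x) ^ (1 : ℝ) := ENNReal.rpow_le_rpow_of_exponent_le h1 ha1
    _ = 1 + x := ENNReal.rpow_one _

/-- **SCALED ENSTROPHY FROM THE CRITICAL GAUGES**: universal `c` with
`E(R/2; z) ≤ c (1 + M)` whenever `(u, p)` is a suitable weak solution on an open `Q ⊇ Q_R(z)` with
weak spatial gradient `G` and `C(R; z), D(R; z) ≤ M`. -/
theorem cknE_half_le_of_cknC_cknD :
    ∃ c : ℝ≥0, ∀ (Q : Opens (ℝ × EuclideanSpace ℝ (Fin 3)))
      (u : ℝ → EuclideanSpace ℝ (Fin 3) → EuclideanSpace ℝ (Fin 3)) (p : ℝ → EuclideanSpace ℝ (Fin 3) → ℝ)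
      (G : ℝ → EuclideanSpace ℝ (Fin 3) → EuclideanSpace ℝ (Fin 3) →L[ℝ] EuclideanSpace ℝ (Fin 3)),
      IsSuitableWeakSolutionOn Q 1 0 u p → HasWeakSpatialGradientOn Q u G →
      ∀ (z : ℝ × EuclideanSpace ℝ (Fin 3)) (R : ℝ), 0 < R →
        parabolicCylinder R z ⊆ (Q : Set (ℝ × EuclideanSpace ℝ (Fin 3))) →
        ∀ M : ℝ≥0∞, cknC R z u ≤ M → cknD R z p ≤ M →
          cknE (R / 2) z G ≤ (c : ℝ≥0∞) * (1 + M) := by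
  obtain ⟨c₁, c₂, c₃, H⟩ := Seregin2020.localEnergyBound_top
  refine ⟨c₁ + c₂ + c₃, fun Q u p G hsw hG z R hR hQ M hC hD => ?_⟩
  have h := H Q u p G hsw hG z R hR hQ
  have hE : cknE (R / 2) z G ≤ cknAEss (R / 2) z u + cknE (R / 2) z G := le_add_self
  refine hE.trans (h.trans ?_)
  -- each term is `≤ cᵢ (1 + M)`
  have h23 : (0 : ℝ) ≤ 2 / 3 := by norm_num
  have h13 : (0 : ℝ) ≤ 1 / 3 := by norm_num
  have t1 : cknC R z u ^ (2 / 3 : ℝ) ≤ 1 + M :=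
    (ENNReal.rpow_le_rpow hC h23).trans (ennreal_rpow_le_one_add h23 (by norm_num))
  have t2 : cknC R z u ≤ 1 + M := hC.trans le_add_self
  have t3 : cknD R z p ^ (2 / 3 : ℝ) * cknC R z u ^ (1 / 3 : ℝ) ≤ 1 + M := by
    have h1M : (1 : ℝ≥0∞) ≤ 1 + M := le_self_add
    calc cknD R z p ^ (2 / 3 : ℝ) * cknC R z u ^ (1 / 3 : ℝ)
        ≤ (1 + M) ^ (2 / 3 : ℝ) * (1 + M) ^ (1 / 3 : ℝ) :=
          mul_le_mul' (ENNReal.rpow_le_rpow (hD.trans le_add_self) h23)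
            (ENNReal.rpow_le_rpow (hC.trans le_add_self) h13)
      _ = (1 + M) ^ (1 : ℝ) := by
          rw [← ENNReal.rpow_add_of_nonneg (2 / 3 : ℝ) (1 / 3 : ℝ) h23 h13]; norm_num
      _ = 1 + M := ENNReal.rpow_one _
  calc (c₁ : ℝ≥0∞) * cknC R z u ^ (2 / 3 : ℝ) + c₂ * cknC R z u +
        c₃ * (cknD R z p ^ (2 / 3 : ℝ) * cknC R z u ^ (1 / 3 : ℝ))
      ≤ c₁ * (1 + M) + c₂ * (1 + M) + c₃ * (1 + M) := by gcongr
    _ = ((c₁ + c₂ + c₃ : ℝ≥0) : ℝ≥0∞) * (1 + M) := by push_cast; ring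

end

end Summit.NavierStokesRegularity.NavierStokesRegularity.Theorems.SwirlFreeBudget
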